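import Literature.Topology.FourManifolds.MMSWRasmussenGeneralPosition
import Summits.SmoothPoincare4.SmoothPoincare4.Theses.DottedCircleRasmussen

/-!
# Helper `helper_friendsCarrier_Vk_collarChart` (piece 10 of the registered helper `helper_friendsCarrier_Vk`,
stub `stub_friendsCarrier`, line `mk_friends`, skeleton v5) for crux `DcrGap`
(item stmt-SmoothPoincare4-16128, route route-SmoothPoincare4-DottedCircleRasmussen)

**The collar chart of `M_k` from a clocked flow.**  Bookkeeping on the output of
`helper_friendsCarrier_Vk_clockFlow` (a `C^∞` flow `Φ` on `ℝ⁴` with the group law, the clock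
`G_k(Φ(s, x)) = 1 + s` for `x ∈ M_k`, `|s| ≤ 2ε`, and the band clause `Φ(1 - G_k y, y) ∈ M_k` for `y`
off the poles with `|G_k y - 1| < 2ε`): the open band `B = {off the poles} ∩ {|G_k - 1| < 2ε}` is the
diffeomorphic image of `M_k × (-2ε, 2ε)` under `(x, s) ↦ Φ(s, x)`, with inverse
`y ↦ (π y, G_k y - 1)`, `π y = Φ(1 - G_k y, y)`; both `π` and `G_k` are `C^∞` on `B`; the
parametrisation is injective.  This is the `k ≥ 1` replacement of the radial collar
`y ↦ (y/‖y‖, ‖y‖)` of `S³ ⊂ ℝ⁴` in the `k = 0` template (`SliceDiscEndCollar.lean`).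

No definitions, no named facts, no `sorry`.
-/

-- the prescribed namespace `Summit.<P>.<Sub>.…` duplicates `SmoothPoincare4` (P = Sub)
set_option linter.dupNamespace false
set_option linter.style.longLine false

noncomputable section

open scoped Manifold ContDiff Topology
open Set Function Metric Filter
open Literature.Topology.FourManifolds Literature.Topology.FourManifolds.MMSW

namespace Summit.SmoothPoincare4.SmoothPoincare4.Theorems.DcrGap.MkFriends

namespace FriendsCarrierVk

/-- The set of points off the poles is open and `G_k` is `C^∞` on it. [folklore] -/
theorem isOpen_offPoles (k : ℕ) : IsOpen {y : EuclideanSpace ℝ (Fin 4) | ∀ j : Fin k, 0 < holeTerm k j y} :=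
  isOpen_guard 0

/-- The open collar band `{off the poles} ∩ {|G_k - 1| < 2ε}` is open. [folklore] -/
theorem isOpen_band (k : ℕ) (ε : ℝ) :
    IsOpen {y : EuclideanSpace ℝ (Fin 4) | (∀ j : Fin k, 0 < holeTerm k j y) ∧ |levelFun k y - 1| < 2 * ε} := by
  have hc : ContinuousOn (fun y => |levelFun k y - 1|) {y : EuclideanSpace ℝ (Fin 4) | ∀ j : Fin k, 0 < holeTerm k j y} :=
    fun y hy => ((contDiffAt_levelFun fun j => (hy j).ne').continuousAt.sub continuousAt_const).abs.continuousWithinAt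
  have := hc.isOpen_inter_preimage (isOpen_offPoles k) (isOpen_Iio (a := 2 * ε))
  convert this using 1
  ext y; simp only [mem_setOf_eq, mem_inter_iff, mem_preimage, mem_Iio]

/-- **The collar chart of `M_k` from a clocked flow.** [folklore] -/
theorem collarChart {k : ℕ} {Φ : ℝ × EuclideanSpace ℝ (Fin 4) → EuclideanSpace ℝ (Fin 4)} {ε : ℝ}
    (hΦs : ContDiff ℝ ∞ Φ) (h0 : ∀ x, Φ (0, x) = x) (hadd : ∀ s t x, Φ (s, Φ (t, x)) = Φ (s + t, x))
    (hclock : ∀ x ∈ modelBoundary k, ∀ s : ℝ, |s| ≤ 2 * ε →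
      (∀ j, (1 : ℝ) / 2 < holeTerm k j (Φ (s, x))) ∧ levelFun k (Φ (s, x)) = 1 + s)
    (hband : ∀ y, (∀ j, 0 < holeTerm k j y) → |levelFun k y - 1| < 2 * ε →
      Φ (1 - levelFun k y, y) ∈ modelBoundary k) :
    (∀ x ∈ modelBoundary k, ∀ s : ℝ, |s| < 2 * ε →
      (∀ j, 0 < holeTerm k j (Φ (s, x))) ∧ |levelFun k (Φ (s, x)) - 1| < 2 * ε) ∧
    (∀ y, (∀ j, 0 < holeTerm k j y) → |levelFun k y - 1| < 2 * ε →
      Φ (1 - levelFun k y, y) ∈ modelBoundary k ∧ Φ (levelFun k y - 1, Φ (1 - levelFun k y, y)) = y) ∧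
    (∀ x ∈ modelBoundary k, ∀ s : ℝ, |s| < 2 * ε → Φ (1 - levelFun k (Φ (s, x)), Φ (s, x)) = x) ∧
    (∀ x ∈ modelBoundary k, ∀ x' ∈ modelBoundary k, ∀ s s' : ℝ, |s| < 2 * ε → |s'| < 2 * ε →
      Φ (s, x) = Φ (s', x') → s = s' ∧ x = x') ∧
    ContDiffOn ℝ ∞ (levelFun k) {y : EuclideanSpace ℝ (Fin 4) | (∀ j : Fin k, 0 < holeTerm k j y) ∧ |levelFun k y - 1| < 2 * ε} ∧
    ContDiffOn ℝ ∞ (fun y => Φ (1 - levelFun k y, y))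
      {y : EuclideanSpace ℝ (Fin 4) | (∀ j : Fin k, 0 < holeTerm k j y) ∧ |levelFun k y - 1| < 2 * ε} := by
  have hfwd : ∀ x ∈ modelBoundary k, ∀ s : ℝ, |s| < 2 * ε →
      (∀ j, 0 < holeTerm k j (Φ (s, x))) ∧ |levelFun k (Φ (s, x)) - 1| < 2 * ε := by
    intro x hx s hs
    obtain ⟨hh, hG⟩ := hclock x hx s hs.le
    exact ⟨fun j => lt_trans (by norm_num) (hh j), by rw [hG]; simpa using hs⟩
  have hproj : ∀ x ∈ modelBoundary k, ∀ s : ℝ, |s| < 2 * ε → Φ (1 - levelFun k (Φ (s, x)), Φ (s, x)) = x := by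
    intro x hx s hs
    rw [(hclock x hx s hs.le).2, show (1 : ℝ) - (1 + s) = -s by ring, hadd, neg_add_cancel, h0]
  have hGs : ContDiffOn ℝ ∞ (levelFun k) {y : EuclideanSpace ℝ (Fin 4) | (∀ j : Fin k, 0 < holeTerm k j y) ∧ |levelFun k y - 1| < 2 * ε} :=
    fun y hy => (contDiffAt_levelFun fun j => (hy.1 j).ne').contDiffWithinAt
  refine ⟨hfwd, fun y hy hG => ⟨hband y hy hG, ?_⟩, hproj, ?_, hGs, ?_⟩
  · rw [hadd, show levelFun k y - 1 + (1 - levelFun k y) = 0 by ring, h0]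
  · intro x hx x' hx' s s' hs hs' heq
    have hs_eq : s = s' := by
      have h1 := (hclock x hx s hs.le).2
      have h2 := (hclock x' hx' s' hs'.le).2
      rw [heq] at h1
      linarith
    subst hs_eq
    refine ⟨rfl, ?_⟩
    have h1 := hproj x hx s hs
    have h2 := hproj x' hx' s hs'
    rw [heq] at h1
    exact h1.symm.trans h2
  · intro y hy
    have hG : ContDiffAt ℝ ∞ (levelFun k) y := contDiffAt_levelFun fun j => (hy.1 j).ne'
    exact (hΦs.contDiffAt.comp y ((contDiffAt_const.sub hG).prodMk contDiffAt_id)).contDiffWithinAt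

end FriendsCarrierVk

open FriendsCarrierVk in
/-- **Helper `helper_friendsCarrier_Vk_collarChart`** (registered piece of `helper_friendsCarrier_Vk`: the
collar chart of `M_k` from a clocked flow).  For a `C^∞` flow `Φ` with the clock and band clauses of
`helper_friendsCarrier_Vk_clockFlow`: flow lines from `M_k` stay in the open band
`B = {off the poles} ∩ {|G_k - 1| < 2ε}` for `|s| < 2ε`; every `y ∈ B` is `Φ(G_k y - 1, π y)` with
`π y = Φ(1 - G_k y, y) ∈ M_k`; `π (Φ(s, x)) = x`; the parametrisation `(x, s) ↦ Φ(s, x)` of `B` by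
`M_k × (-2ε, 2ε)` is injective; `G_k` and `π` are `C^∞` on `B`. [folklore] -/
theorem helper_friendsCarrier_Vk_collarChart : ∀ (k : ℕ) (Φ : ℝ × EuclideanSpace ℝ (Fin 4) → EuclideanSpace ℝ (Fin 4)) (ε : ℝ), ContDiff ℝ ((⊤ : ℕ∞) : WithTop ℕ∞) Φ → (∀ x, Φ (0, x) = x) → (∀ s t x, Φ (s, Φ (t, x)) = Φ (s + t, x)) → (∀ x ∈ Literature.Topology.FourManifolds.MMSW.modelBoundary k, ∀ s : ℝ, |s| ≤ 2 * ε → (∀ j, (1 : ℝ) / 2 < Literature.Topology.FourManifolds.MMSW.holeTerm k j (Φ (s, x))) ∧ Literature.Topology.FourManifolds.MMSW.levelFun k (Φ (s, x)) = 1 + s) → (∀ y, (∀ j, 0 < Literature.Topology.FourManifolds.MMSW.holeTerm k j y) → |Literature.Topology.FourManifolds.MMSW.levelFun k y - 1| < 2 * ε → Φ (1 - Literature.Topology.FourManifolds.MMSW.levelFun k y, y) ∈ Literature.Topology.FourManifolds.MMSW.modelBoundary k) → (∀ x ∈ Literature.Topology.FourManifolds.MMSW.modelBoundary k, ∀ s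 : ℝ, |s| < 2 * ε → (∀ j, 0 < Literature.Topology.FourManifolds.MMSW.holeTerm k j (Φ (s, x))) ∧ |Literature.Topology.FourManifolds.MMSW.levelFun k (Φ (s, x)) - 1| < 2 * ε) ∧ (∀ y, (∀ j, 0 < Literature.Topology.FourManifolds.MMSW.holeTerm k j y) → |Literature.Topology.FourManifolds.MMSW.levelFun k y - 1| < 2 * ε → Φ (1 - Literature.Topology.FourManifolds.MMSW.levelFun k y, y) ∈ Literature.Topology.FourManifolds.MMSW.modelBoundary k ∧ Φ (Literature.Topology.FourManifolds.MMSW.levelFun k y - 1, Φ (1 - Literature.Topology.FourManifolds.MMSW.levelFun k y, y)) = y) ∧ (∀ x ∈ Literature.Topology.FourManifolds.MMSW.modelBoundary k, ∀ s : ℝ, |s| < 2 * ε → Φ (1 - Literature.Topology.FourManifolds.MMSW.levelFun k (Φ (s, x)), Φ (s, x)) = x) ∧ (∀ x ∈ Literature.Topology.FourManifolds.MMSW.modelBoundary k, ∀ x' ∈ Literature.Topology.FourManifolds.MMSW.modelBoundary k, ∀ s s' : ℝ, |s| < 2 * ε → |s'| < 2 * ε → Φ (s, x) = Φ (s', x')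 → s = s' ∧ x = x') ∧ ContDiffOn ℝ ((⊤ : ℕ∞) : WithTop ℕ∞) (Literature.Topology.FourManifolds.MMSW.levelFun k) {y : EuclideanSpace ℝ (Fin 4) | (∀ j : Fin k, 0 < Literature.Topology.FourManifolds.MMSW.holeTerm k j y) ∧ |Literature.Topology.FourManifolds.MMSW.levelFun k y - 1| < 2 * ε} ∧ ContDiffOn ℝ ((⊤ : ℕ∞) : WithTop ℕ∞) (fun y => Φ (1 - Literature.Topology.FourManifolds.MMSW.levelFun k y, y)) {y : EuclideanSpace ℝ (Fin 4) | (∀ j : Fin k, 0 < Literature.Topology.FourManifolds.MMSW.holeTerm k j y) ∧ |Literature.Topology.FourManifolds.MMSW.levelFun k y - 1| < 2 * ε} :=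
  fun _ _ _ hΦs h0 hadd hclock hband => collarChart hΦs h0 hadd hclock hband

end Summit.SmoothPoincare4.SmoothPoincare4.Theorems.DcrGap.MkFriends

end
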